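import Literature.AlgebraicGeometry.Resolution.NormalizationInExtension
import Literature.AlgebraicGeometry.Motives.FunctionFieldOver
import Literature.AlgebraicGeometry.Resolution.BirationalLocalIso
import Literature.AlgebraicGeometry.Resolution.QuasiProjectiveResolution
import Literature.AlgebraicGeometry.Resolution.ResolutionOfCurves

/-!
# From the normalization of `Y` in `K(X)` to `X` (stub `stub_ofNormalizationIn` of the line
# `degree-p-tower` of the crux `Picover`)

Let `g : X → Y` be a finite dominant morphism of integral schemes, `Y` locally of finite type
over a field `k`, and let `L := K(X)` viewed as a (finite) extension of `K(Y)` through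
`g^♯ = RatFn.functionFieldMap g` (`FunctionFieldOver g`). Let `N := Y^L = normalizationIn Y L` be
the normalization of `Y` in `L` (Mathlib's relative normalization of `Spec L → Spec K(Y) → Y`)
with `ι_N : N → Y`. Assume the function-field identification `K(N) ≃ L` over `K(Y)` (the
statement of the neighbouring stub `stub_functionField_normalizationIn`, taken as a hypothesis).

**Statement.** If `N` has a resolution of singularities then so has `X`.

**Proof.** `Spec L → Y` is `Spec K(X) → X → Y` (`fromSpecExtension_functionFieldOver`), so the
universal property of the relative normalization (Mathlib `Scheme.Hom.normalizationDesc`, `g`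
being integral) gives the comparison map `φ : N → X` with `φ ≫ g = ι_N`; `φ` is integral, and
finite since `ι_N` is (E. Noether, `isFinite_normalizationInι`), hence proper. It is dominant
(`Spec K(X) → X` factors through it) and induces a bijection `K(X) → K(N)`: composed with
`K(N) ≃ L = K(X)` it is a `K(Y)`-algebra endomorphism of the finite extension `K(X)/K(Y)`, hence
bijective (Mathlib `Algebra.IsAlgebraic.algHom_bijective`). So the stalk map of `φ` at the generic
point is an isomorphism, and `φ` is an isomorphism over every normal open of `X`
(`isIso_morphismRestrict_of_isIntegralHom_of_normal`); `X`, being locally of finite type over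
`k`, has a non-empty normal affine open (`exists_isAffineOpen_isIntegrallyClosed`), dense with
dense preimage (irreducibility and dominance). Thus `φ` is proper birational and
`Scheme.HasResolution.of_isBirational` transfers the resolution of `N` to `X`.

Sources: Q. Liu, *Algebraic Geometry and Arithmetic Curves* (2002), Def. 4.1.24, Prop. 4.1.25,
Prop. 4.1.27 (normalization in an extension of the function field); the argument is folklore.
-/

noncomputable section

set_option linter.dupNamespace false -- mandated namespace of this single-conjunct summit

open CategoryTheory AlgebraicGeometry TopologicalSpace
open Literature.AlgebraicGeometry.Resolution Literature.AlgebraicGeometry.Motives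

namespace Summit.ResolutionOfSingularities.ResolutionOfSingularities.Theorems.Picover.OfNormalizationIn

universe u

variable {X Y : Scheme.{u}} [IsIntegral X] [IsIntegral Y] (g : X ⟶ Y) [IsDominant g]

/-- For a dominant morphism `g : X → Y` of integral schemes and `L = K(X)` over `K(Y)` via `g^♯`,
the morphism `Spec L → Spec K(Y) → Y` is `Spec K(X) → X → Y`. [folklore] -/
theorem fromSpecExtension_functionFieldOver :
    fromSpecExtension Y (FunctionFieldOver g) = fromSpecFunctionField X ≫ g := by
  change Spec.map (Y.presheaf.stalkSpecializes (RatFn.specializes_genericPoint g) ≫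
      g.stalkMap (genericPoint X)) ≫ Y.fromSpecStalk (genericPoint Y) =
    X.fromSpecStalk (genericPoint X) ≫ g
  rw [Spec.map_comp, Category.assoc, Scheme.SpecMap_stalkSpecializes_fromSpecStalk,
    Scheme.SpecMap_stalkMap_fromSpecStalk]

/-- **The comparison map `Y^{K(X)} → X`**: for `g : X → Y` finite dominant between integral
schemes there is an integral morphism `φ` from the normalization of `Y` in `K(X)` to `X` with
`φ ≫ g = ι` (the normalization morphism) through which `Spec K(X) → Y^{K(X)}` composes to
`Spec K(X) → X` (universal property of the relative normalization, Mathlib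
`Scheme.Hom.normalizationDesc`). [folklore] -/
theorem exists_comparison [IsFinite g] :
    ∃ φ : normalizationIn Y (FunctionFieldOver g) ⟶ X,
      φ ≫ g = normalizationInι Y (FunctionFieldOver g) ∧
      (fromSpecExtension Y (FunctionFieldOver g)).toNormalization ≫ φ = fromSpecFunctionField X ∧
      IsIntegralHom φ :=
  ⟨(fromSpecExtension Y (FunctionFieldOver g)).normalizationDesc (fromSpecFunctionField X) g
      (fromSpecExtension_functionFieldOver g),
    (fromSpecExtension Y (FunctionFieldOver g)).normalizationDesc_comp _ _ _,
    (fromSpecExtension Y (FunctionFieldOver g)).toNormalization_normalizationDesc _ _ _,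
    inferInstanceAs (IsIntegralHom ((fromSpecExtension Y (FunctionFieldOver g)).normalizationDesc
      (fromSpecFunctionField X) g (fromSpecExtension_functionFieldOver g)))⟩

/-- The function-field map of a composite, in a form robust to rewriting the composite:
if `h = φ ≫ g` then `h^♯ = φ^♯ ∘ g^♯`. [folklore] -/
theorem functionFieldMap_eq_comp_of_eq {N : Scheme.{u}} [IsIntegral N] (φ : N ⟶ X) [IsDominant φ]
    (h : N ⟶ Y) [IsDominant h] (hh : h = φ ≫ g) :
    RatFn.functionFieldMap h = (RatFn.functionFieldMap φ).comp (RatFn.functionFieldMap g) := by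
  subst hh
  exact RatFn.functionFieldMap_comp g φ

/-- A dominant morphism `φ : N → X` of integral schemes whose function-field map
`φ^♯ : K(X) → K(N)` is bijective has an invertible stalk map at the generic point. [folklore] -/
theorem isIso_stalkMap_genericPoint_of_bijective {N : Scheme.{u}} [IsIntegral N] (φ : N ⟶ X)
    [IsDominant φ] (hbij : Function.Bijective (RatFn.functionFieldMap φ)) :
    IsIso (φ.stalkMap (genericPoint N)) := by
  have hη : φ (genericPoint N) = genericPoint X := RatFn.genericPoint_eq_of_isDominant φ
  haveI : IsIso (X.presheaf.stalkSpecializes (RatFn.specializes_genericPoint φ)) := by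
    have key : ∀ (y : X) (h : y ⤳ genericPoint X), y = genericPoint X →
        IsIso (X.presheaf.stalkSpecializes h) := by
      rintro y h rfl
      rw [show X.presheaf.stalkSpecializes h = 𝟙 _ from
        TopCat.Presheaf.stalkSpecializes_refl _ _]
      infer_instance
    exact key _ _ hη
  have h2 : IsIso (X.presheaf.stalkSpecializes (RatFn.specializes_genericPoint φ) ≫
      φ.stalkMap (genericPoint N)) :=
    (ConcreteCategory.isIso_iff_bijective _).mpr hbij
  exact IsIso.of_isIso_comp_left (X.presheaf.stalkSpecializes (RatFn.specializes_genericPoint φ))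
    (φ.stalkMap (genericPoint N))

/-- The local rings at the points of an affine open with integrally closed coordinate ring are
integrally closed (localizations of an integrally closed domain). [folklore] -/
theorem isIntegrallyClosed_stalk_of_isAffineOpen {W : X.Opens} (hW : IsAffineOpen W)
    (hic : IsIntegrallyClosed Γ(X, W)) (x : X) (hx : x ∈ W) :
    IsIntegrallyClosed (X.presheaf.stalk x) := by
  haveI : Nonempty W := ⟨⟨x, hx⟩⟩
  haveI : IsIntegrallyClosed Γ(X, W) := hic
  letI := TopCat.Presheaf.algebra_section_stalk X.presheaf (⟨x, hx⟩ : W)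
  haveI := hW.isLocalization_stalk ⟨x, hx⟩
  exact isIntegrallyClosed_of_isLocalization (X.presheaf.stalk x)
    (hW.primeIdealOf ⟨x, hx⟩).asIdeal.primeCompl (Ideal.primeCompl_le_nonZeroDivisors _)

/-- **From the normalization of `Y` in `K(X)` to `X`.** For `g : X → Y` finite dominant between
integral schemes, `Y` locally of finite type over a field: if the normalization `Y^{K(X)}` of `Y`
in `K(X)` has a resolution then so has `X` — the comparison map `Y^{K(X)} → X` is finite and
birational (an isomorphism over the normal locus of `X`, a dense open since `X` is locally of
finite type over a field). Takes the function-field identification `K(Y^{K(X)}) ≃ K(X)` over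
`K(Y)` as a hypothesis. [folklore] -/
theorem stub_ofNormalizationIn : ∀ (k : Type) [Field k] (X Y : Scheme.{0}) [IsIntegral X] [IsIntegral Y] (f : Y ⟶ Spec (.of k)) [LocallyOfFiniteType f] (g : X ⟶ Y) [IsFinite g] [IsDominant g], (∃ e : (normalizationIn Y (FunctionFieldOver g)).functionField ≃+* FunctionFieldOver g, e.toRingHom.comp (RatFn.functionFieldMap (normalizationInι Y (FunctionFieldOver g))) = algebraMap Y.functionField (FunctionFieldOver g)) → Scheme.HasResolution (normalizationIn Y (FunctionFieldOver g)) → Scheme.HasResolution X := by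
  intro k _ X Y _ _ f _ g _ _ hK hN
  obtain ⟨e, he⟩ := hK
  obtain ⟨φ, hcomp, htn, hint⟩ := exists_comparison g
  -- the normalization morphism `ι : N → Y` is finite (E. Noether), hence so is `φ` (`φ ≫ g = ι`)
  haveI : IsFinite (normalizationInι Y (FunctionFieldOver g)) :=
    isFinite_normalizationInι Y (FunctionFieldOver g) f
  haveI : IsFinite φ := by
    have h1 : IsFinite (φ ≫ g) := by rw [hcomp]; infer_instance
    exact IsFinite.comp_iff.mp h1
  -- `φ` is dominant: `Spec K(X) → X` factors through it
  haveI : IsDominant φ := by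
    have h0 : IsDominant (fromSpecFunctionField X) := inferInstance
    have h1 : IsDominant ((fromSpecExtension Y (FunctionFieldOver g)).toNormalization ≫ φ) := by
      rw [htn]; exact h0
    exact IsDominant.of_comp (fromSpecExtension Y (FunctionFieldOver g)).toNormalization φ
  -- `ι^♯ = φ^♯ ∘ g^♯` on function fields
  have hc : RatFn.functionFieldMap (normalizationInι Y (FunctionFieldOver g)) =
      (RatFn.functionFieldMap φ).comp (RatFn.functionFieldMap g) :=
    functionFieldMap_eq_comp_of_eq g φ _ hcomp.symm
  -- `ψ := e ∘ φ^♯ : K(X) → K(X)` is a `K(Y)`-algebra endomorphism of the finite extension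
  -- `K(X)/K(Y)`, hence bijective; so `φ^♯` is bijective
  let ψ₀ : FunctionFieldOver g →+* FunctionFieldOver g :=
    e.toRingHom.comp (RatFn.functionFieldMap φ)
  have hψ₀ : ∀ r : Y.functionField,
      ψ₀ (algebraMap Y.functionField (FunctionFieldOver g) r) =
        algebraMap Y.functionField (FunctionFieldOver g) r := by
    intro r
    have h1 := RingHom.congr_fun he r
    rw [hc] at h1
    exact h1
  let ψ : FunctionFieldOver g →ₐ[Y.functionField] FunctionFieldOver g :=
    { ψ₀ with commutes' := hψ₀ }
  have hψ : Function.Bijective ψ := Algebra.IsAlgebraic.algHom_bijective ψ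
  have hbij : Function.Bijective (RatFn.functionFieldMap φ) := by
    have h2 : Function.Bijective (fun x => e.symm (e (RatFn.functionFieldMap φ x))) :=
      e.symm.bijective.comp hψ
    simpa using h2
  -- hence the stalk map of `φ` at the generic point is an isomorphism
  have hstalk : IsIso (φ.stalkMap (genericPoint _)) :=
    isIso_stalkMap_genericPoint_of_bijective φ hbij
  -- a non-empty normal affine open `W ⊆ X`, over which `φ` is an isomorphism
  obtain ⟨W, hW, hWne, hic⟩ :=
    exists_isAffineOpen_isIntegrallyClosed X NoetherFiniteIntegralClosure_holds (g ≫ f)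
  have hiso : IsIso (φ ∣_ W) :=
    isIso_morphismRestrict_of_isIntegralHom_of_normal φ hstalk W
      (isIntegrallyClosed_stalk_of_isAffineOpen hW hic)
  -- `W` and `φ⁻¹ W` are dense (non-empty opens of irreducible spaces)
  have hbir : IsBirational φ := by
    refine ⟨W, W.isOpen.dense hWne, (φ ⁻¹ᵁ W).isOpen.dense ?_, hiso⟩
    obtain ⟨y, hy⟩ := φ.denseRange.exists_mem_open W.isOpen hWne
    exact ⟨y, hy⟩
  exact Scheme.HasResolution.of_isBirational φ hbir hN

end Summit.ResolutionOfSingularities.ResolutionOfSingularities.Theorems.Picover.OfNormalizationIn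

end
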